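import Summits.ResolutionOfSingularities.ResolutionOfSingularities.Theorems.FrobeniusClosingSteerVisitLawTelescope
import Summits.ResolutionOfSingularities.ResolutionOfSingularities.Theorems.FrobeniusClosingSteerSigmaTopLegalityOddDivisor

/-!
# Crux `Steer` (stmt-ResolutionOfSingularities-16345), chain W4.1, (Par-S) hARᵒ S1a — clord BOOKKEEPING BRICKS for the visit law
# (the `HasClordAlongAt` words of `…Words12MemberDatum`: uniqueness, associate-invariance, one strip lowers the clord by exactly two)
# (res-type-062 g15; res-L0-w41-plan-1 RULING 156c FILE 2b; over res-type-096's `VisitLaw` bricks p535433; Theses-free support)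

OURS (campaign `res-hironaka`, rung L ★L-G4, slot W4.1; statements about the route's own objects — the word
`Words.HasClordAlongAt R s p i x k` («the cleaned order of the member `s i ^ p` ALONG `x` is EXACTLY `k`»); they replace the role of no printed item
and are NOT statements of the manuscript under review [claim: Hironaka2017, status: under-review]; AI review is weaker than expert review).
Seat res-type-062 g15. Definition-free; no Theses file is imported.

## What is proved

* `clord_unique` — the clord along `x` at a stage is unique.
* `hasClordAlongAt_of_associated` — clord along `x` = clord along `w·x` for `w` a unit of the member (the step parameters of a run are units times
  the tracked `x`: `VisitLawTelescope.excParam_strip_eq_unit_mul`).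
* **`hasClordAlongAt_strip`** — ONE STRIP: in a constant member (`R (k+1) = R k`), a strict-transform step `s k = x′·s (k+1) + g` with `x′ = r·x`
  (`r` a unit), `x` PRIME in the member, and clord along `x` at `k` equal to `n + 2` ⇒ clord along `x` at `k+1` equals `n` (res-type-096's
  `sub_sq_mem_span_pow_add_two` / `exists_cleaner_of_sub_sq_mem_span_pow_add_two`, characteristic `2`).
These, with (α) `VisitLaw.clord_exc_of_pointStep` (p537842: clord `ν − 2` right after the point step), (δ) «point step ⇒ clord ≤ 1» and «strip
⇒ clord ≥ 2» (res-type-072 / legality), count the strips between two visits: `j′ − j = ν/2`, and give clauses 3/4 of the repaired `VisitLawAt`.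

[folklore]
-/

-- `Summit.<S>.<S>.…` duplicates the summit name by design (single-problem summit).
set_option linter.dupNamespace false

open IsLocalRing
open Literature.AlgebraicGeometry.Resolution (SubringDominates)

namespace Summit.ResolutionOfSingularities.ResolutionOfSingularities.Theorems.SwitchingDichotomy

namespace VisitLawClord

open Summit.ResolutionOfSingularities.ResolutionOfSingularities.Theorems.SwitchingDichotomy.Words (HasClordAlongAt)

variable {K : Type} [Field K] {R : ℕ → Subring K} {s : ℕ → K} {p : ℕ}

/-! ## §1 Uniqueness and associate-invariance of the clord -/

/-- The clord along `x` at a stage is unique. [folklore] -/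
theorem clord_unique {i : ℕ} {x : K} {k k' : ℕ} (hk : HasClordAlongAt R s p i x k) (hk' : HasClordAlongAt R s p i x k') :
    k = k' := by
  obtain ⟨hx, hs, ⟨g, hg⟩, hmax⟩ := hk
  obtain ⟨hx', hs', ⟨g', hg'⟩, hmax'⟩ := hk'
  by_contra hne
  rcases Nat.lt_or_gt_of_ne hne with hlt | hgt
  · -- `k + 1 ≤ k'`: the witness of `k'` beats the maximality of `k`
    apply hmax g'
    have hle : Ideal.span {(⟨x, hx⟩ : R i) ^ k'} ≤ Ideal.span {(⟨x, hx⟩ : R i) ^ (k + 1)} :=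
      Ideal.span_singleton_le_span_singleton.mpr (pow_dvd_pow _ hlt)
    exact hle hg'
  · apply hmax' g
    have hle : Ideal.span {(⟨x, hx'⟩ : R i) ^ k} ≤ Ideal.span {(⟨x, hx'⟩ : R i) ^ (k' + 1)} :=
      Ideal.span_singleton_le_span_singleton.mpr (pow_dvd_pow _ hgt)
    exact hle hg

/-- Powers of associates span the same ideal. [folklore] -/
theorem span_pow_eq_of_unit_mul {A : Type*} [CommRing A] {x r : A} (hr : IsUnit r) (n : ℕ) :
    Ideal.span {(r * x) ^ n} = Ideal.span {x ^ n} := by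
  rw [mul_pow]
  exact Ideal.span_singleton_mul_left_unit (hr.pow n) _

/-- **Associate-invariance.** If `x′ = r·x` with `r` a unit of the member `R i`, then the clord along `x′` equals the clord along `x`. [folklore] -/
theorem hasClordAlongAt_of_associated {i : ℕ} {x x' r : K} (hr : r ∈ R i) (hrinv : r⁻¹ ∈ R i) (hr0 : r ≠ 0)
    (hx : x ∈ R i) (hx'r : x' = r * x) {k : ℕ} (hk : HasClordAlongAt R s p i x k) :
    HasClordAlongAt R s p i x' k := by
  obtain ⟨hxR, hs, ⟨g, hg⟩, hmax⟩ := hk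
  have hx'R : x' ∈ R i := by rw [hx'r]; exact (R i).mul_mem hr hx
  have hru : IsUnit (⟨r, hr⟩ : R i) :=
    (Literature.AlgebraicGeometry.Resolution.isUnit_subring_iff_inv_mem _).mpr ⟨hr0, hrinv⟩
  have hxx : (⟨x', hx'R⟩ : R i) = ⟨r, hr⟩ * ⟨x, hxR⟩ := Subtype.ext hx'r
  refine ⟨hx'R, hs, ⟨g, ?_⟩, fun g' hg' => hmax g' ?_⟩
  · rw [hxx, span_pow_eq_of_unit_mul hru]; exact hg
  · rw [hxx, span_pow_eq_of_unit_mul hru] at hg'; exact hg'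

/-! ## §2 One strip lowers the clord along `x` by exactly two -/

/-- **Ring-level core of the strip.** In a subring `S` of `K` (characteristic `2`), if `f − g² = x′²·f′` with `x′` prime and the cleaned order
of `f` along `x′` is exactly `n + 2`, then the cleaned order of `f′` along `x′` is exactly `n` (res-type-096's two cleaner lemmas). [folklore] -/
theorem clord_strip_core [CharP K 2] {S : Subring K} (f f' x' g : S) (hx' : Prime x') (hlaw : f - g ^ 2 = x' ^ 2 * f') {n : ℕ}
    (hk : (∃ g₂ : S, f - g₂ ^ 2 ∈ Ideal.span {x' ^ (n + 2)}) ∧ ∀ γ : S, f - γ ^ 2 ∉ Ideal.span {x' ^ (n + 2 + 1)}) :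
    (∃ γ : S, f' - γ ^ 2 ∈ Ideal.span {x' ^ n}) ∧ ∀ γ : S, f' - γ ^ 2 ∉ Ideal.span {x' ^ (n + 1)} := by
  haveI : CharP S 2 := CharP.subring' K 2 S
  obtain ⟨⟨g₂, hg₂⟩, hmax⟩ := hk
  refine ⟨?_, fun γ hγ => ?_⟩
  · obtain ⟨γ, -, hγ⟩ := VisitLaw.exists_cleaner_of_sub_sq_mem_span_pow_add_two hx' hlaw hg₂
    exact ⟨γ, hγ⟩
  · have h := VisitLaw.sub_sq_mem_span_pow_add_two hlaw hγ
    exact hmax (g + x' * γ) (by simpa [add_assoc] using h)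

/-- Transport of the clord word across EQUAL members (`R i = R i'` as subrings — the member is constant across strips): the clord statement
about `s i ^ p`, proved inside `R i'`, is the word at stage `i`. [folklore] -/
theorem hasClordAlongAt_of_member_eq {i i' : ℕ} (hR : R i = R i') {x : K} {k : ℕ}
    (h : ∃ (hx : x ∈ R i') (hs : s i ^ p ∈ R i'),
      (∃ g : R i', (⟨s i ^ p, hs⟩ : R i') - g ^ p ∈ Ideal.span {(⟨x, hx⟩ : R i') ^ k}) ∧
      ∀ g : R i', (⟨s i ^ p, hs⟩ : R i') - g ^ p ∉ Ideal.span {(⟨x, hx⟩ : R i') ^ (k + 1)}) :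
    HasClordAlongAt R s p i x k := by
  unfold HasClordAlongAt
  rw [hR]
  exact h

/-- **One strip.** Characteristic `2`. Stages `k`, `k+1` with the SAME member (`R (k+1) = R k`), the strict-transform step `s k = x′·s (k+1) + g`
with `g ∈ R k` and `x′ = r·x`, `r` a unit of `R k`, `x ∈ R k` PRIME in `R k`, `s (k+1) ^ 2 ∈ R k`: if the clord along `x` at `k` is `n + 2`, the clord
along `x` at `k + 1` is `n`. [folklore] -/
theorem hasClordAlongAt_strip [CharP K 2] {k : ℕ} (hRk : R (k + 1) = R k) {x x' r g : K}
    (hx : x ∈ R k) (hxprime : Prime (⟨x, hx⟩ : R k)) (hr : r ∈ R k) (hrinv : r⁻¹ ∈ R k) (hr0 : r ≠ 0)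
    (hx'r : x' = r * x) (hg : g ∈ R k) (hstep : s k = x' * s (k + 1) + g) (hs' : s (k + 1) ^ 2 ∈ R k)
    {n : ℕ} (hclord : HasClordAlongAt R s 2 k x (n + 2)) :
    HasClordAlongAt R s 2 (k + 1) x n := by
  -- along `x'` at stage `k`
  have hk' : HasClordAlongAt R s 2 k x' (n + 2) := hasClordAlongAt_of_associated hr hrinv hr0 hx hx'r hclord
  obtain ⟨hx'R, hs, hex, hmax⟩ := hk'
  -- the law in `R k`
  have hlaw : (⟨s k ^ 2, hs⟩ : R k) - ⟨g, hg⟩ ^ 2 = ⟨x', hx'R⟩ ^ 2 * ⟨s (k + 1) ^ 2, hs'⟩ := by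
    apply Subtype.ext
    simp only [AddSubgroupClass.coe_sub, SubmonoidClass.mk_pow, Subring.coe_mul]
    rw [hstep]
    have h2 : (2 : K) = 0 := CharTwo.two_eq_zero
    linear_combination (x' * s (k + 1) * g) * h2
  -- `x'` is prime (a unit multiple of `x`)
  have hru : IsUnit (⟨r, hr⟩ : R k) :=
    (Literature.AlgebraicGeometry.Resolution.isUnit_subring_iff_inv_mem _).mpr ⟨hr0, hrinv⟩
  have hx'prime : Prime (⟨x', hx'R⟩ : R k) := by
    have e : (⟨x', hx'R⟩ : R k) = ⟨r, hr⟩ * ⟨x, hx⟩ := Subtype.ext hx'r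
    rw [e]
    exact (prime_isUnit_mul hru).mpr hxprime
  obtain ⟨hex', hmax'⟩ := clord_strip_core _ _ _ _ hx'prime hlaw ⟨hex, hmax⟩
  -- along `x'` at stage `k+1` (same member), then back to `x`
  have hk1' : HasClordAlongAt R s 2 (k + 1) x' n :=
    hasClordAlongAt_of_member_eq hRk ⟨hx'R, hs', hex', hmax'⟩
  -- `x = r⁻¹ · x'`
  have hxr : x = r⁻¹ * x' := by rw [hx'r]; field_simp
  have hrinv' : r⁻¹⁻¹ ∈ R (k + 1) := by rw [inv_inv, hRk]; exact hr
  exact hasClordAlongAt_of_associated (hRk ▸ hrinv) hrinv' (inv_ne_zero hr0) (hRk ▸ hx'R) hxr hk1'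

/-! ## §3 Counting the strips between two visits -/

section Count

open Summit.ResolutionOfSingularities.ResolutionOfSingularities.Theorems.SwitchingDichotomy.Words (IsSteeredRun)
open Literature.AlgebraicGeometry.Resolution (IsLocalBlowupAlong)

variable {O : ValuationSubring K} {P : (i : ℕ) → Ideal (R i)} {t : K}

/-- **Clord along `x` after `t` strips.** In a steered run at `p = 2` (`R 0` dominated by `O`), let `j < j′` with Hγ «every step strictly between
is the strip along `(x)`», `x` prime in the (constant) member `R (j+1)`, and suppose every such strip is LEGAL in the weak sense «the clord along `x`
before it is `≥ 2`». If the clord along `x` right after the point step is `c₀` (stage `j+1`), then after `t` strips (stage `j+1+t ≤ j′`) it is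
`c₀ − 2t`, and `2t ≤ c₀`. [folklore] -/
theorem clord_after_strips [CharP K 2] (hrun : IsSteeredRun O R P t 2 s) (hR0 : SubringDominates (R 0) O.toSubring)
    {j j' : ℕ} {x : K} (Hγ : ∀ k, j < k → k < j' → ∃ hx : x ∈ R k, P k = Ideal.span {(⟨x, hx⟩ : R k)})
    (hx1 : x ∈ R (j + 1)) (hxprime : Prime (⟨x, hx1⟩ : R (j + 1)))
    (hlegal : ∀ k, j < k → k < j' → ∀ n, HasClordAlongAt R s 2 k x n → 2 ≤ n)
    {c₀ : ℕ} (hstart : HasClordAlongAt R s 2 (j + 1) x c₀) :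
    ∀ t', j + 1 + t' ≤ j' → 2 * t' ≤ c₀ ∧ HasClordAlongAt R s 2 (j + 1 + t') x (c₀ - 2 * t') := by
  have hbl : ∀ i, IsLocalBlowupAlong O (R i) (P i) (R (i + 1)) := fun i => by
    obtain ⟨_, _, -, h, -⟩ := hrun.2 i
    exact h
  have hstep : ∀ i, ∃ x' g : K, ((∃ h : x' ∈ R i, (⟨x', h⟩ : R i) ∈ P i) ∧ x' ≠ 0 ∧
      ∀ y : R i, y ∈ P i → O.valuation (y : K) ≤ O.valuation x') ∧ g ∈ R i ∧ s i = x' * s (i + 1) + g := fun i => by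
    obtain ⟨_, _, -, -, h⟩ := hrun.2 i
    exact h
  have hs2 : ∀ i, s i ^ 2 ∈ R i := fun i => by
    obtain ⟨_, h, -⟩ := hrun.2 i
    exact h
  have hdom : ∀ i, SubringDominates (R i) O.toSubring :=
    SigmaTopLegality.subringDominates_of_isLocalBlowup O R hR0 fun i => (hbl i).isLocalBlowup
  have hconst := VisitLawTelescope.ring_const_of_strips hbl Hγ
  intro t'
  induction t' with
  | zero => intro _; exact ⟨by omega, by simpa using hstart⟩
  | succ t' ih =>
    intro ht
    set k := j + 1 + t' with hkdef
    have hk : k < j' := by omega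
    obtain ⟨h2t, hclk⟩ := ih hk.le
    have hRk : R k = R (j + 1) := hconst k (by omega) hk.le
    have hRk1 : R (k + 1) = R k := (hconst (k + 1) (by omega) (by omega)).trans hRk.symm
    -- legality of the strip at `k`: clord ≥ 2
    have hge : 2 ≤ c₀ - 2 * t' := hlegal k (by omega) hk _ hclk
    obtain ⟨n, hn⟩ : ∃ n, c₀ - 2 * t' = n + 2 := ⟨c₀ - 2 * t' - 2, by omega⟩
    rw [hn] at hclk
    -- the strip's data
    obtain ⟨hxk, hPk⟩ := Hγ k (by omega) hk
    obtain ⟨x', g, hx', hg, hsk⟩ := hstep k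
    have hx'' : (∃ h : x' ∈ R k, (⟨x', h⟩ : R k) ∈ Ideal.span {(⟨x, hxk⟩ : R k)}) ∧ x' ≠ 0 ∧
        ∀ y : R k, y ∈ Ideal.span {(⟨x, hxk⟩ : R k)} → O.valuation (y : K) ≤ O.valuation x' := by
      obtain ⟨⟨h1, h2⟩, h3, h4⟩ := hx'
      exact ⟨⟨h1, hPk ▸ h2⟩, h3, fun y hy => h4 y (hPk ▸ hy)⟩
    obtain ⟨r, hr, hrinv, hr0, hx'r⟩ := VisitLawTelescope.excParam_strip_eq_unit_mul (hdom k) ⟨x, hxk⟩ hx''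
    -- `x` is prime in `R k = R (j+1)`
    have hxprime_k : ∃ hx : x ∈ R k, Prime (⟨x, hx⟩ : R k) := by
      rw [hRk]; exact ⟨hx1, hxprime⟩
    obtain ⟨hxk', hprk⟩ := hxprime_k
    have hclk' : HasClordAlongAt R s 2 k x (n + 2) := hclk
    have hres := hasClordAlongAt_strip hRk1 hxk' hprk hr hrinv hr0 hx'r hg hsk (hRk1 ▸ hs2 (k + 1)) hclk'
    refine ⟨by omega, ?_⟩
    have e1 : j + 1 + (t' + 1) = k + 1 := by omega
    have e2 : c₀ - 2 * (t' + 1) = n := by omega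
    rw [e1, e2]
    exact hres

/-- **The strip count and the residual clord.** With the data of `clord_after_strips` for ALL of `(j, j′)` (`j < j′`), the clord along `x` at the
visit `j′` is `c₀ − 2(j′ − j − 1)` with `2(j′ − j − 1) ≤ c₀`; if moreover the point step at `j′` forces «clord along `x` at `j′` is `≤ 1`» (δ) and
`c₀ = ν − 2` with `2 ≤ ν` ((α), the clord right after the point step of cleaned order `ν`), then `j′ − j = ν / 2` and the clord at `j′` is `ν % 2`.
[folklore] -/
theorem count_eq_half_of_clords {j j' ν c₀ : ℕ} (hjj' : j < j') (hν : 2 ≤ ν) (hc₀ : c₀ = ν - 2)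
    (hle : 2 * (j' - j - 1) ≤ c₀) (hδ : c₀ - 2 * (j' - j - 1) ≤ 1) :
    j' - j = ν / 2 ∧ c₀ - 2 * (j' - j - 1) = ν % 2 := by
  subst hc₀
  omega

/-- **Clauses 2′–4′ of the repaired visit law, from the clord data.** Under the hypotheses of `clord_after_strips` on the whole visit pair and the
two legality facts ((δ) at `j′`, weak legality of the strips), with `c₀ = ν − 2` from (α): the number of steps is `j′ − j = ν / 2` and the clord along
`x` at `j′` is EXACTLY `ν % 2` (so `x` is odd at `j′` iff `ν` is odd). [folklore] -/
theorem clord_at_visit [CharP K 2] (hrun : IsSteeredRun O R P t 2 s) (hR0 : SubringDominates (R 0) O.toSubring)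
    {j j' : ℕ} (hjj' : j < j') {x : K} (Hγ : ∀ k, j < k → k < j' → ∃ hx : x ∈ R k, P k = Ideal.span {(⟨x, hx⟩ : R k)})
    (hx1 : x ∈ R (j + 1)) (hxprime : Prime (⟨x, hx1⟩ : R (j + 1)))
    (hlegal : ∀ k, j < k → k < j' → ∀ n, HasClordAlongAt R s 2 k x n → 2 ≤ n)
    {ν : ℕ} (hν : 2 ≤ ν) (hstart : HasClordAlongAt R s 2 (j + 1) x (ν - 2))
    (hδ : ∀ n, HasClordAlongAt R s 2 j' x n → n ≤ 1) :
    j' - j = ν / 2 ∧ HasClordAlongAt R s 2 j' x (ν % 2) := by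
  obtain ⟨hle, hcl⟩ := clord_after_strips hrun hR0 Hγ hx1 hxprime hlegal hstart (j' - j - 1) (by omega)
  have e : j + 1 + (j' - j - 1) = j' := by omega
  rw [e] at hcl
  obtain ⟨hcount, hres⟩ := count_eq_half_of_clords hjj' hν rfl hle (hδ _ hcl)
  rw [hres] at hcl
  exact ⟨hcount, hcl⟩

end Count

end VisitLawClord

end Summit.ResolutionOfSingularities.ResolutionOfSingularities.Theorems.SwitchingDichotomy
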